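import Summits.BirchSwinnertonDyer.BirchSwinnertonDyer.Theorems.ResidualThetaTransportAtTwoLambdaLeCardQuotient
import Summits.BirchSwinnertonDyer.BirchSwinnertonDyer.Theorems.UniversalToricDescentEisensteinSpecializationRank
import Literature.NumberTheory.EllipticCurves.IwasawaAlgebraInvolutionEvenLambdaProofs
import Literature.NumberTheory.GaloisCohomology.Howard2004.ConclusionCurrencyProofs
import Mathlib.NumberTheory.Padics.RingHoms
import HarnessLib

/-!
# Route UniversalToricDescent — the RANK READOUT at Howard's Eisenstein primes, algebraic half:
# «`#(N ⧸ p^k N) ≤ C · p^{k r}` for all `k` ⟹ `rank_{ℤ_p} N ≤ r`», and `#(Φ/R)[a] = #(R ⧸ aR)` for Howard's `𝒟 = Φ/R`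
# (brick (O2) of the port stub `stub_howardOutputsOfFamily`, line `beta-road` v9 on crux `TwinAlgMuZeroAtThree`, stmt-BirchSwinnertonDyer-24737)

Width prover `bsd-wall-utd-p1-w2` g11 under lead `bsd-wall-utd-p1` g23/g24 (`--supports stmt-BirchSwinnertonDyer-24737`, helper). THEOREMS
ONLY (no definition, no named fact, no `sorry`); pure commutative algebra over `ℤ_p`; nothing arithmetic is asserted; BSD is not proved by any
of this; 24737 stays OPEN.

WHY. Conjunct (H-ii) `hrank` of the v9 stub — «`rank_{ℤ₃} X/q_m X ≤ m + C` for infinitely many `m`», `X = X(E′/K_∞)`, `q_m = T^m + 3` — is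
read off Howard's Thm. 1.6.1 (ii) «`H¹_𝓕(K, A_m) ≅ Φ/S_m ⊕ M ⊕ M`» (`DVRSetting.Conclusion`, `FracModR S_m × (M × M)`) through the
discrete readout `ι₀` (finite index in `Sel_∞[ψ_m]`, cell x9/x10b's `PrintX10bControlDiscreteGlue` currency) and the Pontryagin identification
`X/q_m X ≅ Hom(Sel_∞[ψ_m], ℚ/ℤ)`, `(X/q_mX)/p^k ≅ Hom(Sel_∞[ψ_m][p^k], ℚ/ℤ)` (tree `PontryaginCard.exists_quotSMulTop_addEquiv_characterModule_ker`).
So `hrank` reduces to COUNTING `p^k`-torsion: `#Sel_∞[ψ_m][p^k] ≤ c · #(Φ/S_m)[p^{k+e}] · #M² = C · p^{km}`. This file supplies the two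
algebraic ends of that count:

* §1 `natCard_padicInt_quotient_span_pow` (`#(ℤ_p/p^k) = p^k`), `natCard_quotient_span_pow_smul_top` (`#(N/p^k N) = p^{k·rank N}` for `N`
  free), `pow_mul_finrank_baseChange_le_natCard_quotient_pow` / `pow_mul_lambdaInvariant_le_natCard_quotient_pow` (`p^{k·λ(M)} ≤ #(M/p^k M)`
  for every finitely generated `ℤ_p`-module with a compatible `Λ`-structure — the `p^k`-twin of the tree's
  `LambdaLowerBound.pow_lambdaInvariant_le_natCard_quotient`).
* §2 **`lambdaInvariant_le_of_natCard_quotient_pow_le`** — if `#(M ⧸ p^k M) ≤ C · p^{k r}` for all `k`, then `λ(M) = rank_{ℤ_p} M ≤ r`; and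
  the `Λ`-ideal form `…_lambda` (`(p^k) • M` as a `Λ`-submodule, the shape produced by the Pontryagin lemmas).
* §3 **`FracModR.natCard_torsionBy_eq`** — for a domain `R` and `a ≠ 0`: `#{d ∈ Φ/R : a • d = 0} = #(R ⧸ aR)` (`r ↦ [r/a]` is onto the
  `a`-torsion with kernel `aR`), the count of Howard's divisible summand `𝒟 = Φ/R`.
* §4 **`natCard_pow_torsion_fracModR_eisensteinQuotient`** — at `S_m = Λ/(q_m)`, `q_m = T^m + p` (`m ≥ 1`; `S_m` is `ℤ_p`-free of rank `m`,
  p748126 `free_finrank_quotient_X_pow_add_C`): `#(Φ_m/S_m)[p^k] = #(S_m ⧸ p^k S_m) = p^{km}` for every `k` — the growth rate `m` that (H-ii)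
  reads as `rank_{ℤ_p} X/q_m X ≤ m + C`.

References: [Howard2004HeegnerKolyvagin] Thm. 1.6.1 (`𝒟 = Φ/R`), proof of Thm. 2.2.10; [Washington1997] §13.2 (`λ` as a `ℤ_p`-rank);
[GreenbergLNM1716] §4 p. 98 (`X/θX` dual to `Sel[θ]`).
-/

set_option linter.dupNamespace false
set_option autoImplicit false

noncomputable section

open scoped Classical TensorProduct nonZeroDivisors

namespace Summit.BirchSwinnertonDyer.BirchSwinnertonDyer.Theorems.UniversalToricDescentEisensteinCorankReadout

open Literature.NumberTheory.EllipticCurves Literature.NumberTheory.EllipticCurves.IwasawaAlgebra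
  Summit.BirchSwinnertonDyer.BirchSwinnertonDyer.Theorems.LambdaLowerBound

universe u

variable (p : ℕ) [hp : Fact p.Prime]

/-! ## §1 `p^{k·λ(M)} ≤ #(M ⧸ p^k M)` -/

/-- `#(ℤ_p ⧸ p^k) = p^k` (`ℤ_p/p^k ≅ ℤ/p^k` by `PadicInt.toZModPow`). [folklore] -/
theorem natCard_padicInt_quotient_span_pow (k : ℕ) :
    Nat.card (ℤ_[p] ⧸ Ideal.span {(p : ℤ_[p]) ^ k}) = p ^ k := by
  rw [← PadicInt.ker_toZModPow,
    Nat.card_congr (RingHom.quotientKerEquivOfSurjective (ZMod.ringHom_surjective (PadicInt.toZModPow k))).toEquiv,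
    Nat.card_zmod]

/-- **`#(N ⧸ p^k N) = p^{k · rank N}`** for a finitely generated free `ℤ_p`-module `N`. [folklore] -/
theorem natCard_quotient_span_pow_smul_top (N : Type u) [AddCommGroup N] [Module ℤ_[p] N]
    [Module.Finite ℤ_[p] N] [Module.Free ℤ_[p] N] (k : ℕ) :
    Nat.card (N ⧸ (Ideal.span {(p : ℤ_[p]) ^ k} • (⊤ : Submodule ℤ_[p] N))) = p ^ (k * Module.finrank ℤ_[p] N) := by
  rw [← Nat.card_congr (TensorProduct.quotTensorEquivQuotSMul N (Ideal.span {(p : ℤ_[p]) ^ k})).toEquiv]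
  let b := Module.Free.chooseBasis ℤ_[p] N
  haveI : Finite (Module.Free.ChooseBasisIndex ℤ_[p] N) := Module.Finite.finite_basis b
  let b' := Algebra.TensorProduct.basis (ℤ_[p] ⧸ Ideal.span {(p : ℤ_[p]) ^ k}) b
  rw [Nat.card_congr b'.equivFun.toEquiv, Nat.card_fun, Module.finrank_eq_nat_card_basis b,
    natCard_padicInt_quotient_span_pow, ← pow_mul]

/-- `M ⧸ p^k M` is finite for a finitely generated `ℤ_p`-module `M`. [folklore] -/
theorem finite_quotient_span_pow_smul_top (M : Type u) [AddCommGroup M] [Module ℤ_[p] M] [Module.Finite ℤ_[p] M] (k : ℕ) :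
    Finite (M ⧸ (Ideal.span {(p : ℤ_[p]) ^ k} • (⊤ : Submodule ℤ_[p] M))) := by
  haveI : Finite (ℤ_[p] ⧸ Ideal.span {(p : ℤ_[p]) ^ k}) :=
    Nat.finite_of_card_ne_zero (by rw [natCard_padicInt_quotient_span_pow]; exact pow_ne_zero _ hp.out.ne_zero)
  haveI : Finite (M ⧸ (⊤ : Submodule ℤ_[p] M)) := by
    haveI : Subsingleton (M ⧸ (⊤ : Submodule ℤ_[p] M)) := Submodule.Quotient.subsingleton_iff.mpr rfl
    infer_instance
  exact Submodule.finite_quotient_smul (Ideal.span {(p : ℤ_[p]) ^ k}) Module.Finite.fg_top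

/-- **`p^{k · dim_{ℚ_p}(ℚ_p ⊗ M)} ≤ #(M ⧸ p^k M)`** for every finitely generated `ℤ_p`-module `M`: `M/p^k M` maps onto `(M/T)/p^k(M/T)`
(`T` the torsion submodule, `M/T` free of rank `dim_{ℚ_p}(ℚ_p ⊗ M)`), whose order is `p^{k·rank}`. [cite: Washington1997, §13.2] -/
theorem pow_mul_finrank_baseChange_le_natCard_quotient_pow (M : Type u) [AddCommGroup M] [Module ℤ_[p] M]
    [Module.Finite ℤ_[p] M] (k : ℕ) :
    p ^ (k * Module.finrank ℚ_[p] (ℚ_[p] ⊗[ℤ_[p]] M)) ≤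
      Nat.card (M ⧸ (Ideal.span {(p : ℤ_[p]) ^ k} • (⊤ : Submodule ℤ_[p] M))) := by
  set T := Submodule.torsion ℤ_[p] M with hT
  set I : Ideal ℤ_[p] := Ideal.span {(p : ℤ_[p]) ^ k} with hI
  haveI : Module.Free ℤ_[p] (M ⧸ T) := Module.free_of_finite_type_torsion_free'
  haveI := finite_quotient_span_pow_smul_top p M k
  rw [finrank_baseChange_eq_finrank_quotientTorsion p M, ← natCard_quotient_span_pow_smul_top p (M ⧸ T) k]
  -- the surjection `M/IM → (M/T)/I(M/T)`
  have hle : I • (⊤ : Submodule ℤ_[p] M) ≤ (I • (⊤ : Submodule ℤ_[p] (M ⧸ T))).comap (Submodule.mkQ T) := by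
    rw [← Submodule.map_le_iff_le_comap, Submodule.map_smul'', Submodule.map_top, Submodule.range_mkQ]
  refine Nat.card_le_card_of_surjective (Submodule.mapQ _ _ (Submodule.mkQ T) hle) ?_
  rintro ⟨x⟩
  obtain ⟨y, rfl⟩ := Submodule.mkQ_surjective T x
  exact ⟨Submodule.Quotient.mk y, rfl⟩

/-- **`p^{k·λ(M)} ≤ #(M ⧸ p^k M)`** for a `Λ`-module finitely generated over a compatible `ℤ_p`-structure (`λ` = the tree's `lambdaInvariant`,
`= dim_{ℚ_p}(ℚ_p ⊗_{ℤ_p} M)` by `lambdaInvariant_eq_finrank_tensorProduct`). [cite: Washington1997, §13.2] -/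
theorem pow_mul_lambdaInvariant_le_natCard_quotient_pow (M : Type u) [AddCommGroup M] [Module (IwasawaAlgebra p) M]
    [Module ℤ_[p] M] [IsScalarTower ℤ_[p] (IwasawaAlgebra p) M] [Module.Finite ℤ_[p] M] (k : ℕ) :
    p ^ (k * lambdaInvariant p M) ≤ Nat.card (M ⧸ (Ideal.span {(p : ℤ_[p]) ^ k} • (⊤ : Submodule ℤ_[p] M))) := by
  rw [lambdaInvariant_eq_finrank_tensorProduct]
  exact pow_mul_finrank_baseChange_le_natCard_quotient_pow p M k

/-! ## §2 `#(M ⧸ p^k M) ≤ C · p^{k r}` for all `k` ⟹ `λ(M) ≤ r` -/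

/-- **The rank readout from torsion-level counts.** For a `Λ`-module `M` finitely generated over a compatible `ℤ_p`-structure: if
`#(M ⧸ p^k M) ≤ C · p^{k r}` for every `k`, then `λ(M) = rank_{ℤ_p} M ≤ r` (`p^{kλ} ≤ C p^{kr}` for all `k` forces `λ ≤ r`).
[cite: Washington1997, §13.2] [cite: Howard2004HeegnerKolyvagin, proof of Thm. 2.2.10] -/
theorem lambdaInvariant_le_of_natCard_quotient_pow_le (M : Type u) [AddCommGroup M] [Module (IwasawaAlgebra p) M]
    [Module ℤ_[p] M] [IsScalarTower ℤ_[p] (IwasawaAlgebra p) M] [Module.Finite ℤ_[p] M] (C r : ℕ)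
    (h : ∀ k : ℕ, Nat.card (M ⧸ (Ideal.span {(p : ℤ_[p]) ^ k} • (⊤ : Submodule ℤ_[p] M))) ≤ C * p ^ (k * r)) :
    lambdaInvariant p M ≤ r := by
  by_contra hlt
  rw [not_le] at hlt
  have hp1 : 1 < p := hp.out.one_lt
  -- choose `k` with `C < p^k`
  obtain ⟨k, hk⟩ : ∃ k : ℕ, C < p ^ k := ⟨C, Nat.lt_pow_self hp1⟩
  have h1 := (pow_mul_lambdaInvariant_le_natCard_quotient_pow p M k).trans (h k)
  -- `p^{k(r+1)} ≤ p^{kλ} ≤ C p^{kr} < p^k · p^{kr} = p^{k(r+1)}`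
  have h2 : p ^ (k * (r + 1)) ≤ p ^ (k * lambdaInvariant p M) :=
    Nat.pow_le_pow_right hp.out.pos (Nat.mul_le_mul_left k hlt)
  have h3 : C * p ^ (k * r) < p ^ (k * (r + 1)) := by
    calc C * p ^ (k * r) < p ^ k * p ^ (k * r) := Nat.mul_lt_mul_of_pos_right hk (pow_pos hp.out.pos _)
      _ = p ^ (k * (r + 1)) := by rw [Nat.mul_succ, pow_add, mul_comm]
  omega

/-- The `Λ`-submodule `(p^k)·M` and the `ℤ_p`-submodule `p^k M` have the same elements (compatible structures). [folklore] -/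
theorem mem_span_pow_smul_top_iff (M : Type u) [AddCommGroup M] [Module (IwasawaAlgebra p) M]
    [Module ℤ_[p] M] [IsScalarTower ℤ_[p] (IwasawaAlgebra p) M] (k : ℕ) (x : M) :
    x ∈ (Ideal.span {((p : IwasawaAlgebra p)) ^ k} • (⊤ : Submodule (IwasawaAlgebra p) M)) ↔
      x ∈ (Ideal.span {(p : ℤ_[p]) ^ k} • (⊤ : Submodule ℤ_[p] M)) := by
  have hpp : ∀ y : M, ((p : ℤ_[p]) ^ k) • y = ((p : IwasawaAlgebra p) ^ k) • y := fun y ↦ by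
    rw [← map_natCast (algebraMap ℤ_[p] (IwasawaAlgebra p)) p, ← map_pow, algebraMap_smul]
  rw [Submodule.ideal_span_singleton_smul, Submodule.ideal_span_singleton_smul,
    Submodule.mem_smul_pointwise_iff_exists, Submodule.mem_smul_pointwise_iff_exists]
  constructor
  · rintro ⟨y, -, rfl⟩
    exact ⟨y, Submodule.mem_top, hpp y⟩
  · rintro ⟨y, -, rfl⟩
    exact ⟨y, Submodule.mem_top, (hpp y).symm⟩

/-- The two quotients `M ⧸ (p^k)·M` (over `Λ`) and `M ⧸ p^k M` (over `ℤ_p`) have the same cardinality. [folklore] -/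
theorem natCard_quotient_span_pow_smul_top_lambda_eq (M : Type u) [AddCommGroup M] [Module (IwasawaAlgebra p) M]
    [Module ℤ_[p] M] [IsScalarTower ℤ_[p] (IwasawaAlgebra p) M] (k : ℕ) :
    Nat.card (M ⧸ (Ideal.span {((p : IwasawaAlgebra p)) ^ k} • (⊤ : Submodule (IwasawaAlgebra p) M))) =
      Nat.card (M ⧸ (Ideal.span {(p : ℤ_[p]) ^ k} • (⊤ : Submodule ℤ_[p] M))) :=
  Nat.card_congr (Quotient.congr (Equiv.refl M) fun a b => by
    rw [Submodule.quotientRel_def, Submodule.quotientRel_def, Equiv.refl_apply, Equiv.refl_apply]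
    exact mem_span_pow_smul_top_iff p M k (a - b))

/-- **The rank readout, `Λ`-ideal form**: if `#(M ⧸ (p^k)·M) ≤ C · p^{k r}` for every `k` (quotients by the `Λ`-submodules `(p^k) • M` —
the shape delivered by the Pontryagin lemmas `PontryaginCard.exists_quotSMulTop_addEquiv_characterModule_ker`), then `λ(M) ≤ r`.
[cite: Washington1997, §13.2] -/
theorem lambdaInvariant_le_of_natCard_quotient_pow_le_lambda (M : Type u) [AddCommGroup M] [Module (IwasawaAlgebra p) M]
    [Module ℤ_[p] M] [IsScalarTower ℤ_[p] (IwasawaAlgebra p) M] [Module.Finite ℤ_[p] M] (C r : ℕ)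
    (h : ∀ k : ℕ, Nat.card (M ⧸ (Ideal.span {((p : IwasawaAlgebra p)) ^ k} •
      (⊤ : Submodule (IwasawaAlgebra p) M))) ≤ C * p ^ (k * r)) :
    lambdaInvariant p M ≤ r :=
  lambdaInvariant_le_of_natCard_quotient_pow_le p M C r fun k ↦ by
    rw [← natCard_quotient_span_pow_smul_top_lambda_eq p M k]; exact h k

/-! ## §3 Howard's divisible summand `𝒟 = Φ/R`: `#𝒟[a] = #(R ⧸ aR)` -/

section FracMod

open Literature.NumberTheory.GaloisCohomology.Howard2004

variable {R : Type} [CommRing R] [IsDomain R]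

/-- The class of `r/a` in `Φ/R`. [cite: Howard2004HeegnerKolyvagin, §1.6 (𝒟 = Φ/R)] -/
theorem smul_mk_div_eq_zero (a : R) (ha : a ≠ 0) (r : R) :
    a • (Submodule.Quotient.mk ((algebraMap R (FractionRing R) r) * (algebraMap R (FractionRing R) a)⁻¹) : FracModR R) = 0 := by
  have ha' : algebraMap R (FractionRing R) a ≠ 0 := IsFractionRing.to_map_ne_zero_of_mem_nonZeroDivisors
    (mem_nonZeroDivisors_of_ne_zero ha)
  rw [← Submodule.Quotient.mk_smul, Submodule.Quotient.mk_eq_zero, Algebra.smul_def, mul_comm,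
    mul_assoc, inv_mul_cancel₀ ha', mul_one]
  exact ⟨r, by simp [Algebra.smul_def]⟩

/-- **`{d ∈ Φ/R : a • d = 0} ≃ R ⧸ aR`** for `a ≠ 0` in a domain `R`: `r ↦ [r/a]` is onto the `a`-torsion (if `a·x ∈ R`, say `a x = r`, then
`x = r/a`) with kernel `aR` (`r/a ∈ R ⟺ r ∈ aR`). [cite: Howard2004HeegnerKolyvagin, §1.6 (𝒟 = Φ/R)] -/
theorem FracModR.natCard_torsionBy_eq (a : R) (ha : a ≠ 0) :
    Nat.card {d : FracModR R // a • d = 0} = Nat.card (R ⧸ Ideal.span {a}) := by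
  set K := FractionRing R
  have ha' : algebraMap R K a ≠ 0 := IsFractionRing.to_map_ne_zero_of_mem_nonZeroDivisors (mem_nonZeroDivisors_of_ne_zero ha)
  -- the map `R → 𝒟[a]`, `r ↦ [r/a]`
  let φ : R →ₗ[R] FracModR R :=
    { toFun := fun r ↦ Submodule.Quotient.mk ((algebraMap R K r) * (algebraMap R K a)⁻¹)
      map_add' := fun r s ↦ by rw [← Submodule.Quotient.mk_add, map_add, add_mul]
      map_smul' := fun c r ↦ by
        rw [← Submodule.Quotient.mk_smul, RingHom.id_apply, smul_eq_mul, map_mul, Algebra.smul_def, mul_assoc] }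
  have hφ : ∀ r, φ r = Submodule.Quotient.mk ((algebraMap R K r) * (algebraMap R K a)⁻¹) := fun _ ↦ rfl
  -- kernel `= aR`
  have hker : LinearMap.ker φ = Ideal.span {a} := by
    ext r
    rw [LinearMap.mem_ker, hφ, Submodule.Quotient.mk_eq_zero, Ideal.mem_span_singleton', Submodule.mem_one]
    constructor
    · rintro ⟨s, hs⟩
      refine ⟨s, IsFractionRing.injective R K ?_⟩
      rw [map_mul, hs, mul_assoc, inv_mul_cancel₀ ha', mul_one]
    · rintro ⟨s, rfl⟩
      refine ⟨s, ?_⟩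
      rw [map_mul, mul_assoc, mul_inv_cancel₀ ha', mul_one]
  -- range `= 𝒟[a]`
  have hrange : ∀ d : FracModR R, a • d = 0 ↔ d ∈ LinearMap.range φ := by
    intro d
    constructor
    · intro hd
      obtain ⟨x, rfl⟩ := Submodule.Quotient.mk_surjective (p := (1 : Submodule R K)) d
      rw [← Submodule.Quotient.mk_smul, Submodule.Quotient.mk_eq_zero, Submodule.mem_one] at hd
      obtain ⟨r, hr⟩ := hd
      refine ⟨r, ?_⟩
      rw [hφ]
      congr 1
      rw [hr, Algebra.smul_def, mul_comm ((algebraMap R K) a) x, mul_assoc, mul_inv_cancel₀ ha', mul_one]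
    · rintro ⟨r, rfl⟩
      rw [hφ]
      exact smul_mk_div_eq_zero a ha r
  calc Nat.card {d : FracModR R // a • d = 0}
      = Nat.card (LinearMap.range φ) := Nat.card_congr (Equiv.subtypeEquivRight hrange)
    _ = Nat.card (R ⧸ LinearMap.ker φ) := (Nat.card_congr (LinearMap.quotKerEquivRange φ).toEquiv).symm
    _ = Nat.card (R ⧸ Ideal.span {a}) := by rw [hker]

end FracMod

/-! ## §4 At `S_m = Λ/(q_m)`: `#(Φ_m/S_m)[p^k] = p^{km}` -/

section Eisenstein

open Literature.NumberTheory.GaloisCohomology.Howard2004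
  Summit.BirchSwinnertonDyer.BirchSwinnertonDyer.Theorems.UniversalToricDescentEisensteinSpecializationRank

/-- `#(S_m ⧸ (p^k)) = p^{km}` for `S_m = Λ/(q_m)`, `q_m = T^m + p`, `m ≥ 1` (`S_m` is `ℤ_p`-free of rank `m`; the ring ideal `(p^k) ⊂ S_m` and the
`ℤ_p`-submodule `p^k S_m` coincide). [cite: Washington1997, Prop. 13.8] -/
theorem natCard_eisensteinQuotient_quotient_span_pow {m : ℕ} (hm : 1 ≤ m) (k : ℕ) :
    Nat.card ((IwasawaAlgebra p ⧸ Ideal.span {(PowerSeries.X ^ m + PowerSeries.C (p : ℤ_[p]) : IwasawaAlgebra p)}) ⧸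
      Ideal.span {((p : IwasawaAlgebra p ⧸
        Ideal.span {(PowerSeries.X ^ m + PowerSeries.C (p : ℤ_[p]) : IwasawaAlgebra p)}) ^ k)}) = p ^ (k * m) := by
  set R := IwasawaAlgebra p ⧸ Ideal.span {(PowerSeries.X ^ m + PowerSeries.C (p : ℤ_[p]) : IwasawaAlgebra p)} with hR
  obtain ⟨hfree, hfin, hrank⟩ := free_finrank_quotient_X_pow_add_C (p := p) hm
  haveI := hfree
  haveI := hfin
  have hpk : algebraMap ℤ_[p] R ((p : ℤ_[p]) ^ k) = ((p : R) ^ k) := by simp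
  have hsd : ∀ y : R, ((p : ℤ_[p]) ^ k) • y = y * (p : R) ^ k := fun y ↦ by
    have h := Algebra.smul_def ((p : ℤ_[p]) ^ k) y
    rw [hpk, mul_comm] at h
    exact h
  -- the ring ideal `(p^k)` and the `ℤ_p`-submodule `p^k • R` have the same elements
  have hmem : ∀ x : R, x ∈ (Ideal.span {((p : R) ^ k)} : Ideal R) ↔
      x ∈ (Ideal.span {(p : ℤ_[p]) ^ k} • (⊤ : Submodule ℤ_[p] R)) := by
    intro x
    rw [Ideal.mem_span_singleton', Submodule.ideal_span_singleton_smul, Submodule.mem_smul_pointwise_iff_exists]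
    constructor
    · rintro ⟨y, rfl⟩
      exact ⟨y, Submodule.mem_top, hsd y⟩
    · rintro ⟨y, -, rfl⟩
      exact ⟨y, (hsd y).symm⟩
  calc Nat.card (R ⧸ Ideal.span {((p : R) ^ k)})
      = Nat.card (R ⧸ (Ideal.span {(p : ℤ_[p]) ^ k} • (⊤ : Submodule ℤ_[p] R))) :=
        Nat.card_congr (Quotient.congr (Equiv.refl R) fun a b => by
          rw [Submodule.quotientRel_def, Submodule.quotientRel_def, Equiv.refl_apply, Equiv.refl_apply]
          exact hmem (a - b))
    _ = p ^ (k * m) := by rw [natCard_quotient_span_pow_smul_top p R k, hrank]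

/-- **`#(Φ_m/S_m)[p^k] = p^{km}`** for Howard's divisible summand over `S_m = Λ/(q_m)` (`q_m = T^m + p`, `m ≥ 1`; `S_m` a domain): the
`p^k`-torsion of `𝒟 = FracModR S_m` has exactly `#(S_m ⧸ p^k S_m) = p^{km}` elements. With Howard's Thm. 1.6.1 (ii)
`H¹_𝓕(K, A_m) ≅ 𝒟 ⊕ M ⊕ M` this is the growth rate that the rank readout `lambdaInvariant_le_of_natCard_quotient_pow_le` turns into
`rank_{ℤ_p} X/q_m X ≤ m` up to the control constant. [cite: Howard2004HeegnerKolyvagin, Thm. 1.6.1, proof of Thm. 2.2.10] -/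
theorem natCard_pow_torsion_fracModR_eisensteinQuotient {m : ℕ} (hm : 1 ≤ m)
    [IsDomain (IwasawaAlgebra p ⧸ Ideal.span {(PowerSeries.X ^ m + PowerSeries.C (p : ℤ_[p]) : IwasawaAlgebra p)})] (k : ℕ) :
    Nat.card {d : FracModR (IwasawaAlgebra p ⧸
        Ideal.span {(PowerSeries.X ^ m + PowerSeries.C (p : ℤ_[p]) : IwasawaAlgebra p)}) //
      ((p : IwasawaAlgebra p ⧸
        Ideal.span {(PowerSeries.X ^ m + PowerSeries.C (p : ℤ_[p]) : IwasawaAlgebra p)}) ^ k) • d = 0} = p ^ (k * m) := by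
  set R := IwasawaAlgebra p ⧸ Ideal.span {(PowerSeries.X ^ m + PowerSeries.C (p : ℤ_[p]) : IwasawaAlgebra p)} with hR
  obtain ⟨hfree, hfin, -⟩ := free_finrank_quotient_X_pow_add_C (p := p) hm
  haveI := hfree
  -- `p^k ≠ 0` in the `ℤ_p`-free nontrivial ring `S_m`
  have hpk : ((p : R) ^ k) ≠ 0 := by
    intro h0
    have h1 : ((p : ℤ_[p]) ^ k) • (1 : R) = 0 := by
      have h := Algebra.smul_def ((p : ℤ_[p]) ^ k) (1 : R)
      rw [mul_one] at h
      rw [h]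
      simpa using h0
    rcases smul_eq_zero.mp h1 with h | h
    · exact pow_ne_zero k (by exact_mod_cast hp.out.ne_zero : (p : ℤ_[p]) ≠ 0) h
    · exact one_ne_zero h
  rw [FracModR.natCard_torsionBy_eq _ hpk, natCard_eisensteinQuotient_quotient_span_pow p hm k]

end Eisenstein

end Summit.BirchSwinnertonDyer.BirchSwinnertonDyer.Theorems.UniversalToricDescentEisensteinCorankReadout

end
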